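import Summits.Ventures.HodgeRepro2.T5SU11Unimodular
import Mathlib.Analysis.Complex.Polynomial.Basic

/-!
# `U(1,1)` is unimodular

`U(1,1) = {g ∈ GL₂(ℂ) : gᴴ J g = J}` (`J = diag(1, -1)`, `T5UnitaryBound.MemU11`) is realised as a
subgroup of `GL₂(ℂ)`.  Its modular character is trivial: every `g ∈ U(1,1)` has `|det g| = 1`, so
`g = (λ·1) · (λ⁻¹ g)` with `λ² = det g`, where `λ·1` is CENTRAL (the modular character is `1` on
the centre of any locally compact group — `modularCharacterFun_eq_one_of_mem_center`, proved
here) and `λ⁻¹ g ∈ SU(1,1)` lies in the commutator subgroup of `U(1,1)` (it is the Cayley image of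
an element of the perfect group `SL₂(ℝ)`, `T5SL2Perfect`).  Hence every left Haar measure on
`U(1,1)` is right-invariant and inversion-invariant — the support map's «`H_j = U(1,1)` is
unimodular» (N4.3 / B1).  Rühl's NORMALISATION of the Haar measure is not in this file.

Blind lane: Mathlib + own prefix only; no sorry; axioms ⊆ {propext, Classical.choice, Quot.sound}.
-/

namespace Summit.Ventures.HodgeRepro2.T5U11Unimodular

open MeasureTheory MeasureTheory.Measure Topology T5CayleySU11 T5UnitaryBound
open Matrix hiding J

section center

variable {G : Type*} [Group G] [TopologicalSpace G] [IsTopologicalGroup G] [LocallyCompactSpace G]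

/-- **The modular character is `1` on the centre** of a locally compact group: for central `z`,
right translation by `z` is left translation by `z`, which preserves every left Haar measure. -/
theorem modularCharacterFun_eq_one_of_mem_center {z : G} (hz : z ∈ Subgroup.center G) :
    modularCharacterFun z = 1 := by
  borelize G
  rw [modularCharacterFun_eq_haarScalarFactor (haar : Measure G) z]
  obtain ⟨f, hf⟩ : ∃ f : C(G, ℝ), HasCompactSupport f ∧ 0 ≤ (f : G → ℝ) ∧ f 1 ≠ 0 :=
    exists_continuous_nonneg_pos 1
  apply NNReal.coe_injective
  rw [NNReal.coe_one, haarScalarFactor_eq_integral_div_of_continuous_nonneg_pos _ _ hf]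
  have hmeas : AEMeasurable (fun x : G => x * z) (haar : Measure G) :=
    (continuous_mul_const z).measurable.aemeasurable
  have hint : ∫ x, f x ∂(map (· * z) (haar : Measure G)) = ∫ x, f x ∂(haar : Measure G) := by
    rw [integral_map hmeas f.continuous.aestronglyMeasurable]
    have h : (fun x : G => f (x * z)) = fun x => f (z * x) :=
      funext fun x => by rw [Subgroup.mem_center_iff.mp hz x]
    rw [h]
    exact integral_mul_left_eq_self (fun x => f x) z
  rw [hint, div_self]
  exact ne_of_gt (f.continuous.integral_pos_of_hasCompactSupport_nonneg_nonzero hf.1 hf.2.1 hf.2.2)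

end center

/-- `U(1,1) ⊂ GL₂(ℂ)`: the matrices with `gᴴ J g = J`. -/
def U11 : Subgroup (GL (Fin 2) ℂ) where
  carrier := {g | MemU11 (g : Matrix (Fin 2) (Fin 2) ℂ)}
  one_mem' := by simp [MemU11]
  mul_mem' := by
    intro g h hg hh
    simp only [Set.mem_setOf_eq, MemU11, Units.val_mul, conjTranspose_mul] at *
    calc (h : Matrix (Fin 2) (Fin 2) ℂ)ᴴ * (g : Matrix (Fin 2) (Fin 2) ℂ)ᴴ * J *
          ((g : Matrix (Fin 2) (Fin 2) ℂ) * (h : Matrix (Fin 2) (Fin 2) ℂ))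
        = (h : Matrix (Fin 2) (Fin 2) ℂ)ᴴ * ((g : Matrix (Fin 2) (Fin 2) ℂ)ᴴ * J *
            (g : Matrix (Fin 2) (Fin 2) ℂ)) * (h : Matrix (Fin 2) (Fin 2) ℂ) := by
          simp only [Matrix.mul_assoc]
      _ = J := by rw [hg, hh]
  inv_mem' := by
    intro g hg
    simp only [Set.mem_setOf_eq, MemU11] at *
    set A : Matrix (Fin 2) (Fin 2) ℂ := (g : Matrix (Fin 2) (Fin 2) ℂ) with hA
    set B : Matrix (Fin 2) (Fin 2) ℂ := ((g⁻¹ : GL (Fin 2) ℂ) : Matrix (Fin 2) (Fin 2) ℂ) with hB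
    have h1 : A * B = 1 := Units.mul_inv g
    calc Bᴴ * J * B = Bᴴ * (Aᴴ * J * A) * B := by rw [hg]
      _ = (A * B)ᴴ * J * (A * B) := by simp only [conjTranspose_mul, Matrix.mul_assoc]
      _ = J := by rw [h1, conjTranspose_one, Matrix.one_mul, Matrix.mul_one]

/-- Membership in `U(1,1)` is the condition `gᴴ J g = J`. -/
theorem mem_U11_iff (g : GL (Fin 2) ℂ) : g ∈ U11 ↔ MemU11 (g : Matrix (Fin 2) (Fin 2) ℂ) :=
  Iff.rfl

/-- Every element of `U(1,1)` has `|det g|² = conj (det g) · det g = 1`. -/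
theorem normSq_det_eq_one {g : GL (Fin 2) ℂ} (hg : g ∈ U11) :
    Complex.normSq (g : Matrix (Fin 2) (Fin 2) ℂ).det = 1 := by
  have h := congr_arg Matrix.det ((mem_U11_iff g).mp hg)
  rw [det_mul, det_mul, det_conjTranspose, T5UnitaryBound.det_J] at h
  set d : ℂ := (g : Matrix (Fin 2) (Fin 2) ℂ).det with hd
  have h' : star d * d = 1 := by
    calc star d * d = -(star d * -1 * d) := by ring
      _ = -(-1) := by rw [h]
      _ = 1 := by norm_num
  have := Complex.normSq_eq_conj_mul_self (z := d)
  rw [← Complex.star_def, h'] at this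
  exact_mod_cast this

/-- The scalar matrix `λ · 1` as an element of `GL₂(ℂ)` (`λ ≠ 0`). -/
noncomputable def scalarUnit (lam : ℂ) (hlam : lam ≠ 0) : GL (Fin 2) ℂ :=
  ⟨lam • 1, lam⁻¹ • 1, by rw [smul_mul_smul_comm, Matrix.one_mul, mul_inv_cancel₀ hlam, one_smul],
    by rw [smul_mul_smul_comm, Matrix.one_mul, inv_mul_cancel₀ hlam, one_smul]⟩

/-- The matrix of `scalarUnit λ`. -/
@[simp] lemma coe_scalarUnit (lam : ℂ) (hlam : lam ≠ 0) :
    ((scalarUnit lam hlam : GL (Fin 2) ℂ) : Matrix (Fin 2) (Fin 2) ℂ) = lam • 1 :=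
  rfl

/-- The matrix of `(scalarUnit λ)⁻¹`. -/
@[simp] lemma coe_scalarUnit_inv (lam : ℂ) (hlam : lam ≠ 0) :
    (((scalarUnit lam hlam)⁻¹ : GL (Fin 2) ℂ) : Matrix (Fin 2) (Fin 2) ℂ) = lam⁻¹ • 1 :=
  rfl

/-- A scalar matrix `λ · 1` with `|λ| = 1` lies in `U(1,1)`. -/
theorem scalarUnit_mem (lam : ℂ) (hlam : lam ≠ 0) (h1 : Complex.normSq lam = 1) :
    scalarUnit lam hlam ∈ U11 := by
  rw [mem_U11_iff, coe_scalarUnit, MemU11, conjTranspose_smul, conjTranspose_one, smul_mul_assoc,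
    Matrix.one_mul, mul_smul_comm, Matrix.mul_one, smul_smul, Complex.star_def, mul_comm,
    ← Complex.normSq_eq_conj_mul_self, h1, Complex.ofReal_one, one_smul]

/-- Scalar matrices are central in `GL₂(ℂ)`. -/
theorem scalarUnit_mem_center (lam : ℂ) (hlam : lam ≠ 0) :
    scalarUnit lam hlam ∈ Subgroup.center (GL (Fin 2) ℂ) := by
  rw [Subgroup.mem_center_iff]
  intro g
  apply Units.ext
  rw [Units.val_mul, Units.val_mul, coe_scalarUnit, mul_smul_comm, smul_mul_assoc, Matrix.mul_one,
    Matrix.one_mul]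

/-- The Cayley homomorphism `SL₂(ℝ) →* GL₂(ℂ)`. -/
noncomputable def cayleyGL : SpecialLinearGroup (Fin 2) ℝ →* GL (Fin 2) ℂ :=
  SpecialLinearGroup.toGL.comp T5SU11Unimodular.cayleyHom

/-- The matrix of `cayleyGL g`. -/
lemma coe_cayleyGL (g : SpecialLinearGroup (Fin 2) ℝ) :
    ((cayleyGL g : GL (Fin 2) ℂ) : Matrix (Fin 2) (Fin 2) ℂ) =
      cayleyConj ((g : Matrix (Fin 2) (Fin 2) ℝ).map Complex.ofReal) :=
  rfl

/-- The Cayley image of `SL₂(ℝ)` lies in `U(1,1)`. -/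
theorem cayleyGL_mem (g : SpecialLinearGroup (Fin 2) ℝ) : cayleyGL g ∈ U11 := by
  rw [mem_U11_iff, coe_cayleyGL]
  exact (T5SU11Unimodular.mem_SU11_iff (T5SU11Unimodular.cayleyHom g)).mp ⟨g, rfl⟩

/-- The Cayley homomorphism `SL₂(ℝ) →* U(1,1)`. -/
noncomputable def cayleyU : SpecialLinearGroup (Fin 2) ℝ →* U11 :=
  cayleyGL.codRestrict U11 cayleyGL_mem

/-- The matrix of `cayleyU g`. -/
lemma coe_cayleyU (g : SpecialLinearGroup (Fin 2) ℝ) :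
    (((cayleyU g : U11) : GL (Fin 2) ℂ) : Matrix (Fin 2) (Fin 2) ℂ) =
      cayleyConj ((g : Matrix (Fin 2) (Fin 2) ℝ).map Complex.ofReal) :=
  rfl

/-- Every element of `U(1,1)` of determinant `1` is in the Cayley image of `SL₂(ℝ)`. -/
theorem mem_range_cayleyU_of_det_eq_one (h : U11)
    (hdet : ((h : GL (Fin 2) ℂ) : Matrix (Fin 2) (Fin 2) ℂ).det = 1) : h ∈ cayleyU.range := by
  obtain ⟨p, q, r, s, hpqrs, hh⟩ :=
    exists_real_of_memU11_det_one ((mem_U11_iff (h : GL (Fin 2) ℂ)).mp h.2) hdet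
  refine ⟨⟨!![p, q; r, s], by simp [Matrix.det_fin_two_of, hpqrs]⟩, Subtype.ext (Units.ext ?_)⟩
  rw [coe_cayleyU, hh, T5SU11Unimodular.map_ofReal_eq]
  simp

/-- Every element of `U(1,1)` of determinant `1` lies in the commutator subgroup of `U(1,1)`
(the Cayley image of the perfect group `SL₂(ℝ)`). -/
theorem mem_commutator_of_det_eq_one (h : U11)
    (hdet : ((h : GL (Fin 2) ℂ) : Matrix (Fin 2) (Fin 2) ℂ).det = 1) : h ∈ commutator U11 := by
  obtain ⟨x, hx⟩ := mem_range_cayleyU_of_det_eq_one h hdet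
  have hmap : h ∈ (commutator (SpecialLinearGroup (Fin 2) ℝ)).map cayleyU :=
    Subgroup.mem_map.mpr ⟨x, by rw [T5SL2Perfect.commutator_eq_top_real]; trivial, hx⟩
  rw [map_commutator_eq] at hmap
  exact Subgroup.commutator_mono le_top le_top hmap

/-- `U(1,1)` is closed in `GL₂(ℂ)`. -/
theorem isClosed_U11 : IsClosed (U11 : Set (GL (Fin 2) ℂ)) := by
  have h : (U11 : Set (GL (Fin 2) ℂ)) =
      (fun g : GL (Fin 2) ℂ => (g : Matrix (Fin 2) (Fin 2) ℂ)ᴴ * J * (g : Matrix (Fin 2) (Fin 2) ℂ))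
        ⁻¹' {J} := by
    ext g
    simp only [SetLike.mem_coe, mem_U11_iff, MemU11, Set.mem_preimage, Set.mem_singleton_iff]
  rw [h]
  exact isClosed_singleton.preimage
    ((Units.continuous_val.matrix_conjTranspose.matrix_mul continuous_const).matrix_mul
      Units.continuous_val)

/-- `M₂(ℂ)ᵐᵒᵖ` is locally compact. -/
instance instLocallyCompactSpaceMop : LocallyCompactSpace (Matrix (Fin 2) (Fin 2) ℂ)ᵐᵒᵖ :=
  MulOpposite.opHomeomorph.symm.isClosedEmbedding.locallyCompactSpace

/-- `GL₂(ℂ)` is locally compact (closed in `M₂(ℂ) × M₂(ℂ)ᵐᵒᵖ` through `Units.embedProduct`). -/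
instance instLocallyCompactSpaceGL : LocallyCompactSpace (GL (Fin 2) ℂ) :=
  Units.isClosedEmbedding_embedProduct.locallyCompactSpace

/-- `U(1,1)` is locally compact. -/
instance instLocallyCompactSpaceU11 : LocallyCompactSpace U11 :=
  isClosed_U11.isClosedEmbedding_subtypeVal.locallyCompactSpace

/-- `M₂(ℂ)ᵐᵒᵖ` is second countable. -/
instance instSecondCountableTopologyMop : SecondCountableTopology (Matrix (Fin 2) (Fin 2) ℂ)ᵐᵒᵖ :=
  MulOpposite.opHomeomorph.symm.isEmbedding.secondCountableTopology

/-- `GL₂(ℂ)` is second countable. -/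
instance instSecondCountableTopologyGL : SecondCountableTopology (GL (Fin 2) ℂ) :=
  Units.isEmbedding_embedProduct.secondCountableTopology

/-- `U(1,1)` is second countable. -/
instance instSecondCountableTopologyU11 : SecondCountableTopology U11 :=
  isClosed_U11.isClosedEmbedding_subtypeVal.isEmbedding.secondCountableTopology

/-- **The modular character of `U(1,1)` is trivial**: `g = (λ·1)(λ⁻¹ g)` with `λ² = det g`,
`λ·1` central and `λ⁻¹ g` of determinant `1`. -/
theorem modularCharacterFun_eq_one (g : U11) : modularCharacterFun g = 1 := by
  obtain ⟨lam, hlam2⟩ :=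
    IsAlgClosed.exists_pow_nat_eq ((g : GL (Fin 2) ℂ) : Matrix (Fin 2) (Fin 2) ℂ).det two_pos
  have hnorm : Complex.normSq lam = 1 := by
    have h := normSq_det_eq_one g.2
    rw [← hlam2, map_pow] at h
    exact (sq_eq_sq₀ (Complex.normSq_nonneg lam) zero_le_one).mp (by simpa using h)
  have hlam0 : lam ≠ 0 := by
    intro h0; rw [h0, map_zero] at hnorm; exact zero_ne_one hnorm
  let z : U11 := ⟨scalarUnit lam hlam0, scalarUnit_mem lam hlam0 hnorm⟩
  have hz : z ∈ Subgroup.center U11 := by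
    rw [Subgroup.mem_center_iff]
    intro x
    apply Subtype.ext
    exact Subgroup.mem_center_iff.mp (scalarUnit_mem_center lam hlam0) (x : GL (Fin 2) ℂ)
  have hdet : (((z⁻¹ * g : U11) : GL (Fin 2) ℂ) : Matrix (Fin 2) (Fin 2) ℂ).det = 1 := by
    rw [Subgroup.coe_mul, Units.val_mul, det_mul]
    show (lam⁻¹ • (1 : Matrix (Fin 2) (Fin 2) ℂ)).det *
      ((g : GL (Fin 2) ℂ) : Matrix (Fin 2) (Fin 2) ℂ).det = 1
    rw [det_smul, det_one, mul_one, Fintype.card_fin, ← hlam2, inv_pow, inv_mul_cancel₀]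
    exact pow_ne_zero 2 hlam0
  have hg : g = z * (z⁻¹ * g) := (mul_inv_cancel_left z g).symm
  rw [hg, modularCharacterFun_map_mul, modularCharacterFun_eq_one_of_mem_center hz,
    T5UnimodularPerfect.modularCharacterFun_eq_one_of_mem_commutator
      (mem_commutator_of_det_eq_one _ hdet), one_mul]

/-- `modularCharacter = 1` on `U(1,1)`. -/
theorem modularCharacter_eq_one : (modularCharacter : U11 →* NNReal) = 1 :=
  MonoidHom.ext fun g => modularCharacterFun_eq_one g

variable [MeasurableSpace U11] [BorelSpace U11]

/-- **`U(1,1)` is unimodular**: every left Haar measure on it is right-invariant. -/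
theorem isMulRightInvariant (μ : Measure U11) [IsHaarMeasure μ] : IsMulRightInvariant μ := by
  refine ⟨fun g => ?_⟩
  rw [isMulLeftInvariant_eq_smul (map (· * g) μ) μ, ← modularCharacterFun_eq_haarScalarFactor μ g,
    modularCharacterFun_eq_one, one_smul]

/-- Every left Haar measure on `U(1,1)` is inversion-invariant. -/
theorem isInvInvariant (μ : Measure U11) [IsHaarMeasure μ] : IsInvInvariant μ :=
  haveI := isMulRightInvariant μ
  T5SU11Unimodular.isInvInvariant_of_isMulRightInvariant_of_secondCountable μ

/-- `∫ f (x * g) ∂μ = ∫ f x ∂μ` on `U(1,1)`. -/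
theorem integral_mul_right (μ : Measure U11) [IsHaarMeasure μ] {E : Type*} [NormedAddCommGroup E]
    [NormedSpace ℝ E] (f : U11 → E) (g : U11) : ∫ x, f (x * g) ∂μ = ∫ x, f x ∂μ :=
  haveI := isMulRightInvariant μ
  integral_mul_right_eq_self f g

/-- `∫ f x⁻¹ ∂μ = ∫ f x ∂μ` on `U(1,1)`. -/
theorem integral_inv (μ : Measure U11) [IsHaarMeasure μ] {E : Type*} [NormedAddCommGroup E]
    [NormedSpace ℝ E] (f : U11 → E) : ∫ x, f x⁻¹ ∂μ = ∫ x, f x ∂μ :=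
  haveI := isInvInvariant μ
  integral_inv_eq_self f μ

end Summit.Ventures.HodgeRepro2.T5U11Unimodular
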